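import Mathlib
import HarnessLib
import Summits.Ventures.LatticeQCDFlow.Scoring.FreeFieldLeapfrogEquilibriumEnergy

/-!
# The smoothing radius of the flow: the `d`-dimensional heat kernel at flow time `t` has mean-square radius `2dt` — `8t` in four dimensions — and the cooling count the row's charge definition matches to it

HONEST FRAMING: exact (Metropolis-corrected) sampling algorithms for lattice gauge theory;
figures of merit are autocorrelation/cost numbers at stated couplings and volumes; no
continuum-physics claim.

Venture `LatticeQCDFlow` (cell pub-lqcd), sub-topic `Scoring`, FANOUT row 21 (`su3-base`).  The row's scored charge is the
clover charge after `n_cool = 60` cooling sweeps, recorded with the convention "`R_s/a = √(8 n_cool/3) ≈ 12.6`"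
(HOME/su3-base/CARD-su3-base.md §3): the SMOOTHING RADIUS `√(8t)` of the gradient flow at flow time `t` (the root-mean-square
radius of the free heat kernel that the linearised flow equation `∂_t B = ΔB` applies to the gauge potential), combined with
the cooling/flow matching `t = n_cool/3`.  This file types the first ingredient exactly and the second as arithmetic only —
OUR WORK over Mathlib's `gaussianReal` and row 2's `Scoring/FreeFieldLeapfrogEquilibriumEnergy` (`integral_sq_gaussianReal`,
`integrable_sq_gaussianReal`); no definition, nothing cited as a fact, no number of ours.  Printed counterparts NAMED ONLY:
Lüscher 2010 (the flow smooths over `√(8t)`), Bonati–D'Elia 2014 (`n_cool` cooling sweeps ≈ flow time `n_cool/3` for the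
Wilson action — a perturbative/empirical matching, NOT claimed here).

## What is proved

* §1 `integral_sq_eval_pi_gaussianReal` — under the product law `⊗_{i<d} N(0, v)` each coordinate has second moment `v`;
  **`integral_normSq_pi_gaussianReal`** — `∫ Σ_i x_i² = d · v`: the heat kernel `(4πt)^{-d/2} e^{−|x|²/4t}` (`v = 2t` per
  coordinate) has MEAN-SQUARE RADIUS `2dt` (**`heatKernel_meanSquareRadius`**), i.e. `8t` for `d = 4`
  (**`heatKernel_meanSquareRadius_four`**): the smoothing radius `√(8t)` is the rms radius of the kernel, exactly.
* §2 arithmetic of the row's convention (value-free beyond the card's own integers): with `t = n/3`, `8t = 8n/3`; at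
  `n = 60` this is `160` (`smoothingRadiusSq_sixty`), and `12.6 < √160 < 12.7` (`sqrt_160_mem`) — the card's "≈ 12.6";
  `8 < √160` and `11 < √160` (`half_extent_lt_sqrt_160`): under that matching the smoothing radius at `n_cool = 60` exceeds
  half the linear extent of both of the row's boxes (`L/a = 16` and `22`), a fact about the protocol's integers to keep next
  to the finite-volume reading of the cooled charge; at `n = 30` (the like-for-like line with the printed comparison)
  `8t = 80` and `8 < √80 < 9` (`sqrt_80_mem`).

NOT CLAIMED: that cooling IS flow at `t = n/3` (named matching only); anything about the interacting flow; that the rms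
radius is the right notion of footprint for the charge; numbers of ours.
-/

noncomputable section

namespace Summit.Ventures.LatticeQCDFlow.Scoring

open MeasureTheory ProbabilityTheory

/-! ## §1 The mean-square radius of the product Gaussian / heat kernel -/

section HeatKernel

variable {d : ℕ} (v : NNReal)

/-- Each coordinate of `⊗_{i<d} N(0, v)` has second moment `v`. -/
theorem integral_sq_eval_pi_gaussianReal (i : Fin d) :
    ∫ x, (x i) ^ 2 ∂(Measure.pi fun _ : Fin d => gaussianReal 0 v) = v := by
  have hmp := measurePreserving_eval (μ := fun _ : Fin d => gaussianReal 0 v) i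
  calc ∫ x, (x i) ^ 2 ∂(Measure.pi fun _ : Fin d => gaussianReal 0 v)
      = ∫ y, y ^ 2 ∂((Measure.pi fun _ : Fin d => gaussianReal 0 v).map (Function.eval i)) :=
        (integral_map hmp.aemeasurable (continuous_id.pow 2).aestronglyMeasurable).symm
    _ = ∫ y, y ^ 2 ∂(gaussianReal 0 v) := by rw [hmp.map_eq]
    _ = v := integral_sq_gaussianReal v

/-- Each squared coordinate is integrable under the product Gaussian. -/
theorem integrable_sq_eval_pi_gaussianReal (i : Fin d) :
    Integrable (fun x : Fin d → ℝ => (x i) ^ 2) (Measure.pi fun _ : Fin d => gaussianReal 0 v) := by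
  have hmp := measurePreserving_eval (μ := fun _ : Fin d => gaussianReal 0 v) i
  have h := (hmp.integrable_comp (integrable_sq_gaussianReal 0 v).aestronglyMeasurable).2 (integrable_sq_gaussianReal 0 v)
  exact h

/-- **`∫ Σ_i x_i² d(⊗_{i<d} N(0, v)) = d · v`.** -/
theorem integral_normSq_pi_gaussianReal :
    ∫ x, ∑ i, (x i) ^ 2 ∂(Measure.pi fun _ : Fin d => gaussianReal 0 v) = d * v := by
  rw [integral_finsetSum _ fun i _ => integrable_sq_eval_pi_gaussianReal v i]
  simp only [integral_sq_eval_pi_gaussianReal, Finset.sum_const, Finset.card_univ, Fintype.card_fin, nsmul_eq_mul]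

/-- **THE HEAT KERNEL AT FLOW TIME `t` HAS MEAN-SQUARE RADIUS `2dt`**: the law `⊗_{i<d} N(0, 2t)` (density
`(4πt)^{-d/2} e^{−|x|²/(4t)}`, the fundamental solution of `∂_t = Δ`) satisfies `∫ |x|² = 2 d t` (`t ≥ 0`). -/
theorem heatKernel_meanSquareRadius {t : ℝ} (ht : 0 ≤ t) :
    ∫ x, ∑ i, (x i) ^ 2 ∂(Measure.pi fun _ : Fin d => gaussianReal 0 (2 * t).toNNReal) = 2 * d * t := by
  rw [integral_normSq_pi_gaussianReal, Real.coe_toNNReal _ (by positivity)]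
  ring

/-- **`d = 4`: the mean-square radius is `8t`**, i.e. the flow's smoothing radius `√(8t)` is the rms radius of the kernel. -/
theorem heatKernel_meanSquareRadius_four {t : ℝ} (ht : 0 ≤ t) :
    ∫ x, ∑ i, (x i) ^ 2 ∂(Measure.pi fun _ : Fin 4 => gaussianReal 0 (2 * t).toNNReal) = 8 * t := by
  rw [heatKernel_meanSquareRadius ht]
  norm_num

/-- The rms radius itself: `√(∫ |x|²) = √(8t)` in four dimensions. -/
theorem sqrt_heatKernel_meanSquareRadius_four {t : ℝ} (ht : 0 ≤ t) :
    Real.sqrt (∫ x, ∑ i, (x i) ^ 2 ∂(Measure.pi fun _ : Fin 4 => gaussianReal 0 (2 * t).toNNReal)) =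
      Real.sqrt (8 * t) := by
  rw [heatKernel_meanSquareRadius_four ht]

end HeatKernel

/-! ## §2 The row's convention in arithmetic -/

/-- Under the matching `t = n/3`, `8t = 8n/3`; at `n = 60` cooling sweeps this is `160`. -/
theorem smoothingRadiusSq_sixty : (8 : ℝ) * ((60 : ℝ) / 3) = 160 := by norm_num

/-- At `n = 30` (the like-for-like line of the row): `8 · (30/3) = 80`. -/
theorem smoothingRadiusSq_thirty : (8 : ℝ) * ((30 : ℝ) / 3) = 80 := by norm_num

/-- `12.6 < √160 < 12.7` — the card's "`R_s/a ≈ 12.6`". -/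
theorem sqrt_160_mem : (12.6 : ℝ) < Real.sqrt 160 ∧ Real.sqrt 160 < 12.7 := by
  constructor
  · rw [show (12.6 : ℝ) = Real.sqrt (12.6 ^ 2) by rw [Real.sqrt_sq (by norm_num)]]
    exact Real.sqrt_lt_sqrt (by norm_num) (by norm_num)
  · rw [show (12.7 : ℝ) = Real.sqrt (12.7 ^ 2) by rw [Real.sqrt_sq (by norm_num)]]
    exact Real.sqrt_lt_sqrt (by norm_num) (by norm_num)

/-- `8 < √80 < 9` — the smoothing radius at `n = 30` under the same matching. -/
theorem sqrt_80_mem : (8 : ℝ) < Real.sqrt 80 ∧ Real.sqrt 80 < 9 := by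
  constructor
  · rw [show (8 : ℝ) = Real.sqrt (8 ^ 2) by rw [Real.sqrt_sq (by norm_num)]]
    exact Real.sqrt_lt_sqrt (by norm_num) (by norm_num)
  · rw [show (9 : ℝ) = Real.sqrt (9 ^ 2) by rw [Real.sqrt_sq (by norm_num)]]
    exact Real.sqrt_lt_sqrt (by norm_num) (by norm_num)

/-- **Under the matching, the `n_cool = 60` smoothing radius exceeds half the linear extent of both of the row's boxes**:
`16/2 = 8 < √160` and `22/2 = 11 < √160` (and already `√80 > 8` at `n = 30` on the `16⁴` box). -/
theorem half_extent_lt_sqrt_160 : (16 : ℝ) / 2 < Real.sqrt 160 ∧ (22 : ℝ) / 2 < Real.sqrt 160 := by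
  have h := sqrt_160_mem.1
  constructor <;> linarith

end Summit.Ventures.LatticeQCDFlow.Scoring
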